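/-
Copyright (c) 2026 the pub-hodgecm-mathlib formalisation cell (harness21).  Prover seat hodgecm-mathlib-LH4-p09 (g11) (K1b desk K2Liu-p14 (g5) DESK WORD #11 (β)
«the ARCH HALF of `hBL₁`»), Track B «K2-LIT» ∕ hLiu418 socket #41 KIND 1, package (K1b-♮), letter (dec-2): THE CORNER IWASAWA REFINEMENT — from a block
decomposition with a unitary mover to the (e∞) four-factor form, with the line's Levi coordinate read off the corner row.  THEOREMS ONLY.
-/
import Summits.HodgeConjecture.HodgeConjecture.Theorems.K2LiuHermitianTubeAction   -- ★ `rotation_mem_and_moeb_I`, `moeb_I_eq_I_iff` (+ ★ Cocycle: `levi_mem_iff`, `transl_mem_iff`, `mul_mem_UJ`)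
import HarnessLib

/-!
# Crux `HLiu418`, socket #41, KIND 1 — (dec-2)∕(β) `K2LiuKindOneLineCornerArchIwasawa`: THE CORNER IWASAWA REFINEMENT OF A BLOCK DECOMPOSITION

Cell `hodgecm-mathlib`, crux item hLiu418 = `stmt-HodgeConjecture-24832` (helper lane `--supports … --as helper`, count-neutral), route of record `HCCMUnconditional`;
squad K2 ∕ K2Liu; K1b desk K2Liu-p14 (g5) DESK WORD #11 (β) (2026-09-05T01:42:53Z): the ARCH HALF of the block letter `hBL₁` of ★ p864248
`K2LiuKindOneLineDecayOneFrame.hdecF₀_of_blockLetter`.  THEOREMS ONLY (no `def`, no `instance`, no notation, no named-fact hypothesis, no `sorry`).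

THE POINT.  The (e∞) reading ★ p863005 `K2LiuKindOneLineCornerArchReading.corner_lineWhittaker_iwasawa` reads the corner line-Whittaker integral at a point of
`U(2,2)` (tube frame `U(J)`, `J = Matrix.J (Fin 2) ℂ`) given in the FOUR-FACTOR form
  `g = m(diag(r,1), diag(r̄⁻¹,1)) · m(U₀) · n(b E₁₁ + c E₁₂ + c̄ E₂₁) · ι(n₁(b₀) · m₁(a,d)) · κ`,
while the block letter `hBL₁` is quantified over BLOCK DECOMPOSITIONS `g = [Y, B; 0, D] · κ` (★ G7 ∕ ★ p862843 currency).  THIS FILE is the matrix algebra in between: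
* §1 `moeb_I_of_unitary` — a unitary element of `U(J)` fixes `i·1` (it commutes with `J`, hence is a rotation `(a b; −b a)`, ★ `rotation_mem_and_moeb_I`);
  `unitary_mover_rel` — if `[Y, B; 0, D]·κ ∈ U(J)` with `κ` unitary then `ν := DᴴY` is unitary and `DᴴB` is hermitian (the matrix `[Y,B;0,D]ᴴ J [Y,B;0,D] = κ J κᴴ`
  is unitary with vanishing corner), so `[Y, Bν; 0, Dν] ∈ U(J) ∩ P_Δ` has the SAME Levi block `Y` (`siegel_of_unitary_mover`);
* §2 the 2×2 RQ step `exists_upper_mul_unitary` (`Y = (r x; 0 n)·v`, `v` unitary, `n = (Σ_k ‖Y 1 k‖²)^{1∕2} > 0`, `‖r‖·n = ‖det Y‖`) and the hermitian normal form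
  `exists_herm_two`;
* §3 THE 4×4 IDENTITY `transl_mul_levi_eq_fourFactor`: `n(X) · m((r, r u n; 0, n), ·) =` the (e∞) four factors with explicit `b c b₀` and `a = (n)`, `d = (n̄⁻¹)`;
* §4 HEAD **`exists_fourFactor_of_blockDecomp`**: for `g ∈ U(J)` with `g = [Y, B; 0, D]·κ`, `κ` unitary: `g =` four factors `· k` with `k ∈ U(J)`, `k · i1 = i1`,
  `aᴴ d = 1`, `r ≠ 0`, and THE READING OF THE CORNER ROW `‖a 0 0‖² = Σ_k ‖Y 1 k‖²`, `‖r‖ · ‖a 0 0‖ = ‖det Y‖`.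
[BorelJacquet1979, §1.2, §4.1]; [Shimura1997, §5.1, §6.4–§6.5]; [MoeglinWaldspurger1995, I.2.2].
HONEST LABEL.  Count-neutral helper, closes no socket: `HC_CM` is proved only modulo the 7 printed citations (2 remaining named inputs: hLiu418 =
`stmt-HodgeConjecture-24832`, h413 = `stmt-HodgeConjecture-24833`) until rung 0 closes.
-/

set_option autoImplicit false
set_option linter.dupNamespace false -- the mandated namespace repeats `HodgeConjecture.HodgeConjecture`

noncomputable section

namespace Summit.HodgeConjecture.HodgeConjecture.Cruxes.HLiu418.K2LiuKindOneLineCornerArchIwasawa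

open Matrix Complex
open scoped ComplexConjugate Matrix BigOperators
open Literature.NumberTheory.ModularForms.SiegelUpperHalfSpace (moeb)
open Summit.HodgeConjecture.HodgeConjecture.Cruxes.HLiu418.K2LiuHermitianTubeCocycle (fromBlocks_conjTranspose_mul_J_mul levi_mem_iff transl_mem_iff mul_mem_UJ
  moeb_mul_of_posDef posDef_im_I_smul_one)
open Summit.HodgeConjecture.HodgeConjecture.Cruxes.HLiu418.K2LiuHermitianTubeAction (rotation_mem_and_moeb_I)

/-! ## §1 Unitary movers -/

section Unitary

variable {l : Type*} [Fintype l] [DecidableEq l]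

/-- **A UNITARY ELEMENT OF `U(J)` FIXES `i·1`**: `kᴴJk = J` and `kᴴk = 1 = kkᴴ` force `Jk = kJ`, so `k = (a b; −b a)` with `aᴴa + bᴴb = 1`, `aᴴb = bᴴa`
(★ `rotation_mem_and_moeb_I`): the maximal compact subgroup `K_w = U(J) ∩ Stab(i·1)` contains `U(J) ∩ U(2l)`. [cite: Shimura1997, §6.5] -/
theorem moeb_I_of_unitary {k : Matrix (l ⊕ l) (l ⊕ l) ℂ} (hk : kᴴ * Matrix.J l ℂ * k = Matrix.J l ℂ) (hku : kᴴ * k = 1) (hku' : k * kᴴ = 1) :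
    moeb k (I • (1 : Matrix l l ℂ)) = I • 1 := by
  have hJk : Matrix.J l ℂ * k = k * Matrix.J l ℂ := by
    calc Matrix.J l ℂ * k = (k * kᴴ) * Matrix.J l ℂ * k := by rw [hku', Matrix.one_mul]
      _ = k * (kᴴ * Matrix.J l ℂ * k) := by simp only [Matrix.mul_assoc]
      _ = k * Matrix.J l ℂ := by rw [hk]
  have hk' : k = fromBlocks k.toBlocks₁₁ k.toBlocks₁₂ k.toBlocks₂₁ k.toBlocks₂₂ := (fromBlocks_toBlocks k).symm
  set a := k.toBlocks₁₁
  set b := k.toBlocks₁₂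
  set c := k.toBlocks₂₁
  set d := k.toBlocks₂₂
  rw [hk'] at hJk hku
  rw [Matrix.J, fromBlocks_multiply, fromBlocks_multiply] at hJk
  simp only [Matrix.zero_mul, Matrix.neg_mul, Matrix.one_mul, zero_add, add_zero, Matrix.mul_zero, Matrix.mul_one, Matrix.mul_neg,
    fromBlocks_inj] at hJk
  obtain ⟨h1, -, h3, -⟩ := hJk
  have hc : c = -b := by rw [← h1, neg_neg]
  have hd : d = a := h3.symm
  rw [hc, hd] at hku hk'
  rw [fromBlocks_conjTranspose, fromBlocks_multiply, ← fromBlocks_one, fromBlocks_inj] at hku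
  obtain ⟨h11, h12, -, -⟩ := hku
  rw [conjTranspose_neg, neg_mul_neg] at h11
  rw [conjTranspose_neg, Matrix.neg_mul, ← sub_eq_add_neg, sub_eq_zero] at h12
  rw [hk']
  exact (rotation_mem_and_moeb_I h11 h12).2

/-- `J · Jᴴ = 1`. [folklore] -/
theorem J_mul_conjTranspose_J : Matrix.J l ℂ * (Matrix.J l ℂ)ᴴ = 1 := by
  rw [Matrix.J, fromBlocks_conjTranspose, fromBlocks_multiply, ← fromBlocks_one]
  simp

/-- **THE RELATIONS OF A UNITARY-MOVER BLOCK DECOMPOSITION**: if `[Y, B; 0, D] · κ ∈ U(J)` with `κ` unitary, then `ν := DᴴY` is unitary and `DᴴB` is hermitian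
(`[Y,B;0,D]ᴴ J [Y,B;0,D] = κJκᴴ` is unitary and equals `(0, −YᴴD; DᴴY, DᴴB − BᴴD)`). [cite: BorelJacquet1979, §1.2] [cite: Shimura1997, §5.1] -/
theorem unitary_mover_rel {Y B D : Matrix l l ℂ} {κ : Matrix (l ⊕ l) (l ⊕ l) ℂ}
    (hg : (fromBlocks Y B 0 D * κ)ᴴ * Matrix.J l ℂ * (fromBlocks Y B 0 D * κ) = Matrix.J l ℂ) (hκ : κ * κᴴ = 1) (hκ' : κᴴ * κ = 1) :
    (Dᴴ * Y)ᴴ * (Dᴴ * Y) = 1 ∧ Bᴴ * D = Dᴴ * B := by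
  have hP : (fromBlocks Y B 0 D)ᴴ * Matrix.J l ℂ * fromBlocks Y B 0 D = κ * Matrix.J l ℂ * κᴴ := by
    rw [conjTranspose_mul] at hg
    calc (fromBlocks Y B 0 D)ᴴ * Matrix.J l ℂ * fromBlocks Y B 0 D
        = (κ * κᴴ) * ((fromBlocks Y B 0 D)ᴴ * Matrix.J l ℂ * fromBlocks Y B 0 D) * (κ * κᴴ) := by rw [hκ, Matrix.one_mul, Matrix.mul_one]
      _ = κ * (κᴴ * (fromBlocks Y B 0 D)ᴴ * Matrix.J l ℂ * (fromBlocks Y B 0 D * κ)) * κᴴ := by simp only [Matrix.mul_assoc]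
      _ = κ * Matrix.J l ℂ * κᴴ := by rw [hg]
  have hM : ((fromBlocks Y B 0 D)ᴴ * Matrix.J l ℂ * fromBlocks Y B 0 D) * ((fromBlocks Y B 0 D)ᴴ * Matrix.J l ℂ * fromBlocks Y B 0 D)ᴴ = 1 := by
    rw [hP, conjTranspose_mul, conjTranspose_mul, conjTranspose_conjTranspose]
    calc κ * Matrix.J l ℂ * κᴴ * (κ * ((Matrix.J l ℂ)ᴴ * κᴴ)) = κ * (Matrix.J l ℂ * (κᴴ * κ) * (Matrix.J l ℂ)ᴴ) * κᴴ := by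
          simp only [Matrix.mul_assoc]
      _ = 1 := by rw [hκ', Matrix.mul_one, J_mul_conjTranspose_J, Matrix.mul_one, hκ]
  rw [fromBlocks_conjTranspose_mul_J_mul] at hM
  simp only [conjTranspose_zero, Matrix.zero_mul, Matrix.mul_zero, sub_zero, zero_sub, fromBlocks_conjTranspose, conjTranspose_neg,
    fromBlocks_multiply, Matrix.neg_mul, Matrix.mul_neg, neg_neg, zero_add, ← fromBlocks_one, fromBlocks_inj] at hM
  obtain ⟨h11, h12, -, -⟩ := hM
  rw [conjTranspose_mul, conjTranspose_conjTranspose] at h11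
  have hνH : (Dᴴ * Y)ᴴ = Yᴴ * D := by rw [conjTranspose_mul, conjTranspose_conjTranspose]
  have h1 : (Dᴴ * Y)ᴴ * (Dᴴ * Y) = 1 := by
    rw [hνH]
    simpa only [Matrix.mul_assoc] using h11
  refine ⟨h1, ?_⟩
  -- `YᴴD` is invertible (`(DᴴY)(YᴴD) = 1`), so `YᴴD · (DᴴB − BᴴD)ᴴ = 0` forces `DᴴB = BᴴD`
  have h1' : Dᴴ * Y * (Yᴴ * D) = 1 := by rw [← hνH]; exact mul_eq_one_comm.1 h1
  have h2 : (Dᴴ * B - Bᴴ * D)ᴴ = 0 := by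
    have h12' : Yᴴ * D * (Dᴴ * B - Bᴴ * D)ᴴ = 0 := by
      rw [neg_eq_zero] at h12
      simpa only [Matrix.mul_assoc] using h12
    calc (Dᴴ * B - Bᴴ * D)ᴴ = (Dᴴ * Y * (Yᴴ * D)) * (Dᴴ * B - Bᴴ * D)ᴴ := by rw [h1', Matrix.one_mul]
      _ = Dᴴ * Y * (Yᴴ * D * (Dᴴ * B - Bᴴ * D)ᴴ) := by simp only [Matrix.mul_assoc]
      _ = 0 := by rw [h12', Matrix.mul_zero]
  have h3 : Dᴴ * B - Bᴴ * D = 0 := by simpa using congrArg conjTranspose h2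
  exact (sub_eq_zero.1 h3).symm

/-- **THE SIEGEL ELEMENT WITH THE SAME LEVI BLOCK**: under the hypotheses of `unitary_mover_rel`, `P′ := [Y, B·ν; 0, D·ν]` with `ν = DᴴY` lies in `U(J)`, and
`g = P′ · k` with `k := [1, 0; 0, νᴴ] · κ` unitary and in `U(J)`. [cite: BorelJacquet1979, §1.2] [cite: Shimura1997, §5.1] -/
theorem siegel_of_unitary_mover {Y B D : Matrix l l ℂ} {κ : Matrix (l ⊕ l) (l ⊕ l) ℂ}
    (hg : (fromBlocks Y B 0 D * κ)ᴴ * Matrix.J l ℂ * (fromBlocks Y B 0 D * κ) = Matrix.J l ℂ) (hκ : κ * κᴴ = 1) (hκ' : κᴴ * κ = 1) :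
    (fromBlocks Y (B * (Dᴴ * Y)) 0 (D * (Dᴴ * Y)))ᴴ * Matrix.J l ℂ * fromBlocks Y (B * (Dᴴ * Y)) 0 (D * (Dᴴ * Y)) = Matrix.J l ℂ ∧
      (fromBlocks 1 0 0 (Dᴴ * Y)ᴴ * κ)ᴴ * Matrix.J l ℂ * (fromBlocks 1 0 0 (Dᴴ * Y)ᴴ * κ) = Matrix.J l ℂ ∧
      (fromBlocks 1 0 0 (Dᴴ * Y)ᴴ * κ)ᴴ * (fromBlocks 1 0 0 (Dᴴ * Y)ᴴ * κ) = 1 ∧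
      (fromBlocks 1 0 0 (Dᴴ * Y)ᴴ * κ) * (fromBlocks 1 0 0 (Dᴴ * Y)ᴴ * κ)ᴴ = 1 ∧
      fromBlocks Y B 0 D * κ = fromBlocks Y (B * (Dᴴ * Y)) 0 (D * (Dᴴ * Y)) * (fromBlocks 1 0 0 (Dᴴ * Y)ᴴ * κ) := by
  obtain ⟨hν, hBD⟩ := unitary_mover_rel hg hκ hκ'
  have hν' : (Dᴴ * Y) * (Dᴴ * Y)ᴴ = 1 := mul_eq_one_comm.1 hν
  -- `P′ ∈ U(J)`
  have hP' : (fromBlocks Y (B * (Dᴴ * Y)) 0 (D * (Dᴴ * Y)))ᴴ * Matrix.J l ℂ * fromBlocks Y (B * (Dᴴ * Y)) 0 (D * (Dᴴ * Y)) = Matrix.J l ℂ := by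
    rw [fromBlocks_conjTranspose_mul_J_mul, Matrix.J]
    have e1 : Yᴴ * (D * (Dᴴ * Y)) = 1 := by
      have : Yᴴ * (D * (Dᴴ * Y)) = (Dᴴ * Y)ᴴ * (Dᴴ * Y) := by rw [conjTranspose_mul, conjTranspose_conjTranspose]; simp only [Matrix.mul_assoc]
      rw [this, hν]
    have e2 : (D * (Dᴴ * Y))ᴴ * Y = 1 := by
      have : (D * (Dᴴ * Y))ᴴ * Y = (Dᴴ * Y)ᴴ * (Dᴴ * Y) := by rw [conjTranspose_mul]; simp only [Matrix.mul_assoc]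
      rw [this, hν]
    have e3 : (D * (Dᴴ * Y))ᴴ * (B * (Dᴴ * Y)) = (B * (Dᴴ * Y))ᴴ * (D * (Dᴴ * Y)) := by
      have tD : (D * (Dᴴ * Y))ᴴ = (Dᴴ * Y)ᴴ * Dᴴ := conjTranspose_mul _ _
      have tB : (B * (Dᴴ * Y))ᴴ = (Dᴴ * Y)ᴴ * Bᴴ := conjTranspose_mul _ _
      rw [tD, tB]
      calc (Dᴴ * Y)ᴴ * Dᴴ * (B * (Dᴴ * Y)) = (Dᴴ * Y)ᴴ * (Dᴴ * B) * (Dᴴ * Y) := by simp only [Matrix.mul_assoc]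
        _ = (Dᴴ * Y)ᴴ * (Bᴴ * D) * (Dᴴ * Y) := by rw [hBD]
        _ = (Dᴴ * Y)ᴴ * Bᴴ * (D * (Dᴴ * Y)) := by simp only [Matrix.mul_assoc]
    simp only [conjTranspose_zero, Matrix.zero_mul, Matrix.mul_zero, sub_zero, zero_sub, e1, e2, e3, sub_self]
  -- the decomposition
  have hdec : fromBlocks Y B 0 D * κ = fromBlocks Y (B * (Dᴴ * Y)) 0 (D * (Dᴴ * Y)) * (fromBlocks 1 0 0 (Dᴴ * Y)ᴴ * κ) := by
    rw [← Matrix.mul_assoc, fromBlocks_multiply]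
    congr 1
    simp only [Matrix.mul_one, Matrix.mul_zero, add_zero, zero_add, Matrix.mul_assoc, hν', Matrix.mul_one]
  -- `k` is unitary
  have hνH : (Dᴴ * Y)ᴴ = Yᴴ * D := by rw [conjTranspose_mul, conjTranspose_conjTranspose]
  have hν'' : Dᴴ * Y * (Yᴴ * D) = 1 := by rw [← hνH]; exact hν'
  have hdu : (fromBlocks 1 0 0 (Dᴴ * Y)ᴴ : Matrix (l ⊕ l) (l ⊕ l) ℂ)ᴴ * fromBlocks 1 0 0 (Dᴴ * Y)ᴴ = 1 := by
    rw [fromBlocks_conjTranspose, fromBlocks_multiply, ← fromBlocks_one, conjTranspose_conjTranspose, hνH]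
    simp [hν'']
  have hdu' : (fromBlocks 1 0 0 (Dᴴ * Y)ᴴ : Matrix (l ⊕ l) (l ⊕ l) ℂ) * (fromBlocks 1 0 0 (Dᴴ * Y)ᴴ)ᴴ = 1 := mul_eq_one_comm.1 hdu
  have hk1 : (fromBlocks 1 0 0 (Dᴴ * Y)ᴴ * κ)ᴴ * (fromBlocks 1 0 0 (Dᴴ * Y)ᴴ * κ) = 1 := by
    rw [conjTranspose_mul]
    calc κᴴ * (fromBlocks 1 0 0 (Dᴴ * Y)ᴴ)ᴴ * (fromBlocks 1 0 0 (Dᴴ * Y)ᴴ * κ) = κᴴ * ((fromBlocks 1 0 0 (Dᴴ * Y)ᴴ)ᴴ * fromBlocks 1 0 0 (Dᴴ * Y)ᴴ) * κ := by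
          simp only [Matrix.mul_assoc]
      _ = 1 := by rw [hdu, Matrix.mul_one, hκ']
  have hk2 : (fromBlocks 1 0 0 (Dᴴ * Y)ᴴ * κ) * (fromBlocks 1 0 0 (Dᴴ * Y)ᴴ * κ)ᴴ = 1 := mul_eq_one_comm.1 hk1
  -- `k ∈ U(J)`: `g = P′ k` with `g, P′ ∈ U(J)`
  have hkJ : (fromBlocks 1 0 0 (Dᴴ * Y)ᴴ * κ)ᴴ * Matrix.J l ℂ * (fromBlocks 1 0 0 (Dᴴ * Y)ᴴ * κ) = Matrix.J l ℂ := by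
    have h := hg
    rw [hdec, conjTranspose_mul] at h
    have h' : (fromBlocks 1 0 0 (Dᴴ * Y)ᴴ * κ)ᴴ * ((fromBlocks Y (B * (Dᴴ * Y)) 0 (D * (Dᴴ * Y)))ᴴ * Matrix.J l ℂ *
        fromBlocks Y (B * (Dᴴ * Y)) 0 (D * (Dᴴ * Y))) * (fromBlocks 1 0 0 (Dᴴ * Y)ᴴ * κ) = Matrix.J l ℂ := by
      simpa only [Matrix.mul_assoc] using h
    rwa [hP'] at h'
  exact ⟨hP', hkJ, hk1, hk2, hdec⟩

end Unitary

/-! ## §2 The 2×2 RQ step and the hermitian normal form -/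

section Two

/-- **2×2 RQ**: an invertible `Y ∈ M₂(ℂ)` is `(r x; 0 n) · v` with `v` unitary, `n > 0` THE NORM OF THE SECOND ROW (`n² = Σ_k ‖Y 1 k‖²`) and `‖r‖ · n = ‖det Y‖`
(the rows of `v` are the normalised second row of `Y` and its unitary complement). [folklore] [cite: BorelJacquet1979, §1.2] -/
theorem exists_upper_mul_unitary (Y : Matrix (Fin 2) (Fin 2) ℂ) (hY : Y.det ≠ 0) :
    ∃ (r x : ℂ) (n : ℝ) (v : Matrix (Fin 2) (Fin 2) ℂ), 0 < n ∧ v * vᴴ = 1 ∧ vᴴ * v = 1 ∧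
      Y = !![r, x; 0, (n : ℂ)] * v ∧ n ^ 2 = ∑ k, ‖Y 1 k‖ ^ 2 ∧ ‖r‖ * n = ‖Y.det‖ := by
  have hρpos : 0 < ‖Y 1 0‖ ^ 2 + ‖Y 1 1‖ ^ 2 := by
    by_contra hle
    have h0 : ‖Y 1 0‖ ^ 2 + ‖Y 1 1‖ ^ 2 = 0 := le_antisymm (not_lt.1 hle) (by positivity)
    have h10 : Y 1 0 = 0 := by
      have : ‖Y 1 0‖ ^ 2 = 0 := by nlinarith [sq_nonneg ‖Y 1 0‖, sq_nonneg ‖Y 1 1‖]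
      exact norm_eq_zero.1 (pow_eq_zero_iff two_ne_zero |>.1 this)
    have h11 : Y 1 1 = 0 := by
      have : ‖Y 1 1‖ ^ 2 = 0 := by nlinarith [sq_nonneg ‖Y 1 0‖, sq_nonneg ‖Y 1 1‖]
      exact norm_eq_zero.1 (pow_eq_zero_iff two_ne_zero |>.1 this)
    apply hY
    rw [Matrix.det_fin_two, h10, h11, mul_zero, mul_zero, sub_zero]
  set n : ℝ := Real.sqrt (‖Y 1 0‖ ^ 2 + ‖Y 1 1‖ ^ 2) with hn_def
  have hn : 0 < n := Real.sqrt_pos.2 hρpos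
  have hn2 : n ^ 2 = ‖Y 1 0‖ ^ 2 + ‖Y 1 1‖ ^ 2 := Real.sq_sqrt hρpos.le
  have hnC : ((n : ℂ)) ^ 2 = Y 1 0 * conj (Y 1 0) + Y 1 1 * conj (Y 1 1) := by
    rw [← ofReal_pow, hn2, ofReal_add, ofReal_pow, ofReal_pow, ← mul_conj', ← mul_conj']
  have hn0 : (n : ℂ) ≠ 0 := ofReal_ne_zero.2 hn.ne'
  refine ⟨Y.det / n, (Y 0 0 * conj (Y 1 0) + Y 0 1 * conj (Y 1 1)) / n, n,
    !![conj (Y 1 1) / n, -conj (Y 1 0) / n; Y 1 0 / n, Y 1 1 / n], hn, ?_, ?_, ?_, ?_, ?_⟩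
  · ext i j
    fin_cases i <;> fin_cases j <;>
      simp [Matrix.mul_apply, Fin.sum_univ_two, conjTranspose_apply] <;> field_simp <;>
      first | linear_combination (-1 : ℂ) * hnC | ring
  · refine mul_eq_one_comm.1 ?_
    ext i j
    fin_cases i <;> fin_cases j <;>
      simp [Matrix.mul_apply, Fin.sum_univ_two, conjTranspose_apply] <;> field_simp <;>
      first | linear_combination (-1 : ℂ) * hnC | ring
  · ext i j
    fin_cases i <;> fin_cases j <;> simp [Matrix.mul_apply, Fin.sum_univ_two, Matrix.det_fin_two] <;> field_simp
    · linear_combination Y 0 0 * hnC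
    · linear_combination Y 0 1 * hnC
  · rw [Fin.sum_univ_two, hn2]
  · rw [norm_div, Complex.norm_real, Real.norm_of_nonneg hn.le, div_mul_cancel₀ _ hn.ne']

/-- a hermitian 2×2 matrix is `(x₀₀ x₀₁; x̄₀₁ x₁₁)` with `x₀₀, x₁₁` real. [folklore] -/
theorem exists_herm_two {X : Matrix (Fin 2) (Fin 2) ℂ} (hX : Xᴴ = X) :
    ∃ (x₀₀ x₁₁ : ℝ) (x₀₁ : ℂ), X = !![(x₀₀ : ℂ), x₀₁; conj x₀₁, (x₁₁ : ℂ)] := by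
  have h : ∀ i j, conj (X j i) = X i j := fun i j => by
    have h := congrFun (congrFun hX i) j
    rwa [conjTranspose_apply, Complex.star_def] at h
  refine ⟨(X 0 0).re, (X 1 1).re, X 0 1, ?_⟩
  ext i j
  fin_cases i <;> fin_cases j
  · exact (conj_eq_iff_re.1 (h 0 0)).symm
  · rfl
  · exact (h 1 0).symm
  · exact (conj_eq_iff_re.1 (h 1 1)).symm

end Two

/-! ## §3 The 4×4 identity: `n(X) · m(Y₀, Y₀⁻ᴴ)` in the (e∞) four-factor form -/

section FourFactor

/-- **THE FOUR-FACTOR IDENTITY.**  For `r ≠ 0`, `n ≠ 0` real, `u ∈ ℂ` and a hermitian `X = (x₀₀ x₀₁; x̄₀₁ x₁₁)`: with `Y₀ = (r, r u n; 0, n)`, `Y₀⁻ᴴ = (r̄⁻¹, 0; −ū, n⁻¹)`,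
`n(X) · m(Y₀, Y₀⁻ᴴ) = m(diag(r,1), diag(r̄⁻¹,1)) · m(U₀) · n(b E₁₁ + c E₁₂ + c̄ E₂₁) · ι(n₁(b₀) · m₁((n), (n⁻¹)))` (the corner map `ι` written out) with
`b₀ = x₁₁`, `c = x₀₁∕r − x₁₁ u`, `b = x₀₀∕‖r‖² − 2 Re(x₀₁ ū ∕ r) + x₁₁ ‖u‖²` — the shape read by ★ `K2LiuKindOneLineCornerArchReading.corner_lineWhittaker_iwasawa`.
[cite: Shimura1997, §5.1] [cite: KudlaRallis1994, §2] -/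
theorem transl_mul_levi_eq_fourFactor {r : ℂ} (hr : r ≠ 0) (u : ℂ) {n : ℝ} (hn : n ≠ 0) (x₀₀ x₁₁ : ℝ) (x₀₁ : ℂ) :
    (fromBlocks 1 !![(x₀₀ : ℂ), x₀₁; conj x₀₁, (x₁₁ : ℂ)] 0 1 : Matrix (Fin 2 ⊕ Fin 2) (Fin 2 ⊕ Fin 2) ℂ) *
        fromBlocks !![r, r * u * n; 0, (n : ℂ)] 0 0 !![(conj r)⁻¹, 0; -conj u, (n : ℂ)⁻¹] =
      fromBlocks !![r, 0; 0, 1] 0 0 !![(conj r)⁻¹, 0; 0, 1] * fromBlocks !![1, u; 0, 1] 0 0 !![1, 0; -conj u, 1] *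
        fromBlocks 1 !![((x₀₀ / ‖r‖ ^ 2 - 2 * (x₀₁ * conj u / r).re + x₁₁ * ‖u‖ ^ 2 : ℝ) : ℂ), x₀₁ / r - x₁₁ * u; conj (x₀₁ / r - x₁₁ * u), 0] 0 1 *
        fromBlocks !![1, 0; 0, (n : ℂ)] !![0, 0; 0, (x₁₁ : ℂ) * (n : ℂ)⁻¹] 0 !![1, 0; 0, (n : ℂ)⁻¹] := by
  have hrc : conj r ≠ 0 := (map_ne_zero _).2 hr
  have hnC : (n : ℂ) ≠ 0 := ofReal_ne_zero.2 hn
  have hb : ((x₀₀ / ‖r‖ ^ 2 - 2 * (x₀₁ * conj u / r).re + x₁₁ * ‖u‖ ^ 2 : ℝ) : ℂ) =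
      x₀₀ / (r * conj r) - (x₀₁ * conj u / r + conj x₀₁ * u / conj r) + x₁₁ * (u * conj u) := by
    have h2 : ((2 * (x₀₁ * conj u / r).re : ℝ) : ℂ) = x₀₁ * conj u / r + conj x₀₁ * u / conj r := by
      rw [← add_conj, map_div₀, map_mul, conj_conj]
    rw [ofReal_add, ofReal_sub, ofReal_div, ofReal_pow, ← mul_conj', h2, ofReal_mul, ofReal_pow, ← mul_conj']
  rw [hb]
  ext i j
  rcases i with i | i <;> rcases j with j | j <;> fin_cases i <;> fin_cases j <;>
    simp [Matrix.mul_apply, Fintype.sum_sum_type, Fin.sum_univ_two, fromBlocks, map_sub, map_mul, map_div₀] <;>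
    field_simp <;> ring

end FourFactor

/-! ## §4 The four-factor form of a unitary-mover block decomposition -/

section Head

/-- `Uᴴ · D₀ = 1` for `U = (r, r u n; 0, n)` and `D₀ = (r̄⁻¹, 0; −ū, n⁻¹)` (`D₀ = U⁻ᴴ`). [folklore] -/
theorem upper_conjTranspose_mul_eq_one {r : ℂ} (hr : r ≠ 0) (u : ℂ) {n : ℝ} (hn : n ≠ 0) :
    (!![r, r * u * n; 0, (n : ℂ)])ᴴ * !![(conj r)⁻¹, 0; -conj u, (n : ℂ)⁻¹] = 1 := by
  have hrc : conj r ≠ 0 := (map_ne_zero _).2 hr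
  have hnC : (n : ℂ) ≠ 0 := ofReal_ne_zero.2 hn
  ext i j
  fin_cases i <;> fin_cases j <;> simp [Matrix.mul_apply, Fin.sum_univ_two, conjTranspose_apply, hrc, hnC]
  field_simp
  ring

/-- **THE FOUR-FACTOR FORM OF A UNITARY-MOVER BLOCK DECOMPOSITION (HEAD).**  Let `g = [Y, B; 0, D] · κ ∈ U(J)` (`J = Matrix.J (Fin 2) ℂ`, the tube frame of `U(2,2)`)
with `κ` unitary.  THEN `g = m(diag(r,1), diag(r̄⁻¹,1)) · m(U₀) · n(b E₁₁ + c E₁₂ + c̄ E₂₁) · ι(n₁(b₀) · m₁((n), (n⁻¹))) · k` — the (e∞) four-factor form, `ι` written out —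
with `k ∈ U(J)` unitary and fixing `i·1` (so the `K_w`-type letter applies to it), `r ≠ 0`, `n > 0`, and THE CORNER ROW READ OFF `Y`:
`n² = Σ_j ‖Y 1 j‖²` (the square of the line's Levi coordinate) and `‖r‖ · n = ‖det Y‖` (the off-corner coordinate).  Route: §1 (`P′ = [Y, Bν; 0, Dν] ∈ U(J)`),
§2 (RQ `Y = U v`, `v` into the compact part), the `U(J)` relations of `P′ m(vᴴ)` (`D″ = U⁻ᴴ`, `B″Uᴴ` hermitian), §3.
[cite: BorelJacquet1979, §1.2, §4.1] [cite: Shimura1997, §5.1, §6.5] [cite: MoeglinWaldspurger1995, I.2.2] -/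
theorem exists_fourFactor_of_blockDecomp {Y B D : Matrix (Fin 2) (Fin 2) ℂ} {κ : Matrix (Fin 2 ⊕ Fin 2) (Fin 2 ⊕ Fin 2) ℂ}
    (hg : (fromBlocks Y B 0 D * κ)ᴴ * Matrix.J (Fin 2) ℂ * (fromBlocks Y B 0 D * κ) = Matrix.J (Fin 2) ℂ) (hκ : κ * κᴴ = 1) (hκ' : κᴴ * κ = 1) :
    ∃ (r u c : ℂ) (b b₀ n : ℝ) (k : Matrix (Fin 2 ⊕ Fin 2) (Fin 2 ⊕ Fin 2) ℂ), r ≠ 0 ∧ 0 < n ∧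
      kᴴ * Matrix.J (Fin 2) ℂ * k = Matrix.J (Fin 2) ℂ ∧ moeb k (I • (1 : Matrix (Fin 2) (Fin 2) ℂ)) = I • 1 ∧ kᴴ * k = 1 ∧
      fromBlocks Y B 0 D * κ =
        fromBlocks !![r, 0; 0, 1] 0 0 !![(conj r)⁻¹, 0; 0, 1] * fromBlocks !![1, u; 0, 1] 0 0 !![1, 0; -conj u, 1] *
          fromBlocks 1 !![(b : ℂ), c; conj c, 0] 0 1 * fromBlocks !![1, 0; 0, (n : ℂ)] !![0, 0; 0, (b₀ : ℂ) * (n : ℂ)⁻¹] 0 !![1, 0; 0, (n : ℂ)⁻¹] * k ∧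
      n ^ 2 = ∑ j, ‖Y 1 j‖ ^ 2 ∧ ‖r‖ * n = ‖Y.det‖ := by
  obtain ⟨hP', hkJ, hk1, -, hdec⟩ := siegel_of_unitary_mover hg hκ hκ'
  -- `det Y ≠ 0` from the Levi relation `Yᴴ (D ν) = 1` of `P′ ∈ U(J)`
  obtain ⟨-, -, hYD, -⟩ := (K2LiuHermitianTubeCocycle.fromBlocks_conjTranspose_mul_J_mul_eq_iff Y (B * (Dᴴ * Y)) 0 (D * (Dᴴ * Y))).1 hP'
  have hYD1 : Yᴴ * (D * (Dᴴ * Y)) = 1 := by simpa using hYD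
  have hdetY : Y.det ≠ 0 := by
    intro h0
    have h := congrArg Matrix.det hYD1
    rw [det_mul, det_conjTranspose, h0, star_zero, zero_mul, det_one] at h
    exact zero_ne_one h
  -- RQ of `Y`
  obtain ⟨r, x, n, v, hn, hv, hv', hYv, hn2, hrn⟩ := exists_upper_mul_unitary Y hdetY
  have hn0 : n ≠ 0 := hn.ne'
  have hnC : (n : ℂ) ≠ 0 := ofReal_ne_zero.2 hn0
  have hr : r ≠ 0 := by
    intro h0
    rw [h0, norm_zero, zero_mul] at hrn
    exact hdetY (norm_eq_zero.1 hrn.symm)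
  set u : ℂ := x / (r * n) with hu
  have hx : x = r * u * n := by rw [hu]; field_simp
  have hYU : Y = !![r, r * u * n; 0, (n : ℂ)] * v := by rw [hYv, hx]
  -- the Levi rotations `m(v, v)`, `m(vᴴ, vᴴ)`
  have hmv : (fromBlocks v 0 0 v : Matrix (Fin 2 ⊕ Fin 2) (Fin 2 ⊕ Fin 2) ℂ)ᴴ * Matrix.J (Fin 2) ℂ * fromBlocks v 0 0 v = Matrix.J (Fin 2) ℂ :=
    (levi_mem_iff v v).2 hv'
  have hmvH : (fromBlocks vᴴ 0 0 vᴴ : Matrix (Fin 2 ⊕ Fin 2) (Fin 2 ⊕ Fin 2) ℂ)ᴴ * Matrix.J (Fin 2) ℂ * fromBlocks vᴴ 0 0 vᴴ = Matrix.J (Fin 2) ℂ :=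
    (levi_mem_iff vᴴ vᴴ).2 (by rw [conjTranspose_conjTranspose, hv])
  have hvv : (fromBlocks vᴴ 0 0 vᴴ : Matrix (Fin 2 ⊕ Fin 2) (Fin 2 ⊕ Fin 2) ℂ) * fromBlocks v 0 0 v = 1 := by
    rw [fromBlocks_multiply, ← fromBlocks_one]
    simp [hv']
  -- `P″ := P′ · m(vᴴ, vᴴ) = [U, B″; 0, D″]`, `k₂ := m(v, v) · k₁`
  set B₂ : Matrix (Fin 2) (Fin 2) ℂ := B * (Dᴴ * Y) * vᴴ with hB₂
  set D₂ : Matrix (Fin 2) (Fin 2) ℂ := D * (Dᴴ * Y) * vᴴ with hD₂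
  have hYvH : Y * vᴴ = !![r, r * u * n; 0, (n : ℂ)] := by rw [hYU, Matrix.mul_assoc, hv, Matrix.mul_one]
  have hP₂ : fromBlocks Y (B * (Dᴴ * Y)) 0 (D * (Dᴴ * Y)) * fromBlocks vᴴ 0 0 vᴴ = fromBlocks !![r, r * u * n; 0, (n : ℂ)] B₂ 0 D₂ := by
    rw [fromBlocks_multiply, hYvH]
    simp [hB₂, hD₂]
  have hP₂J : (fromBlocks !![r, r * u * n; 0, (n : ℂ)] B₂ 0 D₂)ᴴ * Matrix.J (Fin 2) ℂ * fromBlocks !![r, r * u * n; 0, (n : ℂ)] B₂ 0 D₂ = Matrix.J (Fin 2) ℂ := by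
    rw [← hP₂]; exact mul_mem_UJ hP' hmvH
  set k₂ : Matrix (Fin 2 ⊕ Fin 2) (Fin 2 ⊕ Fin 2) ℂ := fromBlocks v 0 0 v * (fromBlocks 1 0 0 (Dᴴ * Y)ᴴ * κ) with hk₂
  have hdec₂ : fromBlocks Y B 0 D * κ = fromBlocks !![r, r * u * n; 0, (n : ℂ)] B₂ 0 D₂ * k₂ := by
    rw [hdec, ← hP₂, hk₂]
    calc fromBlocks Y (B * (Dᴴ * Y)) 0 (D * (Dᴴ * Y)) * (fromBlocks 1 0 0 (Dᴴ * Y)ᴴ * κ)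
        = fromBlocks Y (B * (Dᴴ * Y)) 0 (D * (Dᴴ * Y)) * (fromBlocks vᴴ 0 0 vᴴ * fromBlocks v 0 0 v) * (fromBlocks 1 0 0 (Dᴴ * Y)ᴴ * κ) := by
          rw [hvv, Matrix.mul_one]
      _ = _ := by simp only [Matrix.mul_assoc]
  have hk₂J : k₂ᴴ * Matrix.J (Fin 2) ℂ * k₂ = Matrix.J (Fin 2) ℂ := mul_mem_UJ hmv hkJ
  have hk₂u : k₂ᴴ * k₂ = 1 := by
    rw [hk₂, conjTranspose_mul]
    calc (fromBlocks 1 0 0 (Dᴴ * Y)ᴴ * κ)ᴴ * (fromBlocks v 0 0 v)ᴴ * (fromBlocks v 0 0 v * (fromBlocks 1 0 0 (Dᴴ * Y)ᴴ * κ))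
        = (fromBlocks 1 0 0 (Dᴴ * Y)ᴴ * κ)ᴴ * ((fromBlocks v 0 0 v)ᴴ * fromBlocks v 0 0 v) * (fromBlocks 1 0 0 (Dᴴ * Y)ᴴ * κ) := by
          simp only [Matrix.mul_assoc]
      _ = 1 := by
          have h1 : (fromBlocks v 0 0 v : Matrix (Fin 2 ⊕ Fin 2) (Fin 2 ⊕ Fin 2) ℂ)ᴴ * fromBlocks v 0 0 v = 1 := by
            rw [fromBlocks_conjTranspose, fromBlocks_multiply, ← fromBlocks_one]
            simp [hv']
          rw [h1, Matrix.mul_one, hk1]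
  have hk₂I : moeb k₂ (I • (1 : Matrix (Fin 2) (Fin 2) ℂ)) = I • 1 := moeb_I_of_unitary hk₂J hk₂u (mul_eq_one_comm.1 hk₂u)
  -- the `U(J)` relations of `P″`: `D″ = U⁻ᴴ = D₀`, `B″ Uᴴ` hermitian
  obtain ⟨-, hBD₂, hUD, -⟩ := (K2LiuHermitianTubeCocycle.fromBlocks_conjTranspose_mul_J_mul_eq_iff _ B₂ 0 D₂).1 hP₂J
  have hUD1 : (!![r, r * u * n; 0, (n : ℂ)])ᴴ * D₂ = 1 := by simpa using hUD
  have hD₀ : D₂ = !![(conj r)⁻¹, 0; -conj u, (n : ℂ)⁻¹] :=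
    (Matrix.inv_eq_right_inv hUD1).symm.trans (Matrix.inv_eq_right_inv (upper_conjTranspose_mul_eq_one hr u hn0))
  have hDU : D₂ * (!![r, r * u * n; 0, (n : ℂ)])ᴴ = 1 := mul_eq_one_comm.1 hUD1
  have hUD' : !![r, r * u * n; 0, (n : ℂ)] * D₂ᴴ = 1 := by
    have h := congrArg conjTranspose hDU
    rwa [conjTranspose_mul, conjTranspose_conjTranspose, conjTranspose_one] at h
  have hX : (B₂ * (!![r, r * u * n; 0, (n : ℂ)])ᴴ)ᴴ = B₂ * (!![r, r * u * n; 0, (n : ℂ)])ᴴ := by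
    rw [conjTranspose_mul, conjTranspose_conjTranspose]
    calc !![r, r * u * n; 0, (n : ℂ)] * B₂ᴴ = !![r, r * u * n; 0, (n : ℂ)] * B₂ᴴ * (D₂ * (!![r, r * u * n; 0, (n : ℂ)])ᴴ) := by rw [hDU, Matrix.mul_one]
      _ = !![r, r * u * n; 0, (n : ℂ)] * (B₂ᴴ * D₂) * (!![r, r * u * n; 0, (n : ℂ)])ᴴ := by simp only [Matrix.mul_assoc]
      _ = !![r, r * u * n; 0, (n : ℂ)] * (D₂ᴴ * B₂) * (!![r, r * u * n; 0, (n : ℂ)])ᴴ := by rw [hBD₂]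
      _ = (!![r, r * u * n; 0, (n : ℂ)] * D₂ᴴ) * B₂ * (!![r, r * u * n; 0, (n : ℂ)])ᴴ := by simp only [Matrix.mul_assoc]
      _ = B₂ * (!![r, r * u * n; 0, (n : ℂ)])ᴴ := by rw [hUD', Matrix.one_mul]
  obtain ⟨x₀₀, x₁₁, x₀₁, hXe⟩ := exists_herm_two hX
  -- `P″ = n(X″) · m(U, D₀)`
  have hP₂' : fromBlocks !![r, r * u * n; 0, (n : ℂ)] B₂ 0 D₂ =
      fromBlocks 1 !![(x₀₀ : ℂ), x₀₁; conj x₀₁, (x₁₁ : ℂ)] 0 1 * fromBlocks !![r, r * u * n; 0, (n : ℂ)] 0 0 !![(conj r)⁻¹, 0; -conj u, (n : ℂ)⁻¹] := by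
    rw [← hXe, fromBlocks_multiply, ← hD₀]
    congr 1 <;> simp only [Matrix.one_mul, Matrix.mul_zero, Matrix.zero_mul, add_zero, zero_add]
    rw [Matrix.mul_assoc, hUD1, Matrix.mul_one]
  refine ⟨r, u, x₀₁ / r - x₁₁ * u, x₀₀ / ‖r‖ ^ 2 - 2 * (x₀₁ * conj u / r).re + x₁₁ * ‖u‖ ^ 2, x₁₁, n, k₂, hr, hn, hk₂J, hk₂I, hk₂u, ?_, hn2, hrn⟩
  rw [hdec₂, hP₂', transl_mul_levi_eq_fourFactor hr u hn0 x₀₀ x₁₁ x₀₁]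

end Head



end Summit.HodgeConjecture.HodgeConjecture.Cruxes.HLiu418.K2LiuKindOneLineCornerArchIwasawa

end
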